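import Literature.MathematicalPhysics.QuantumLattice.GrassmannEffectiveActionTruncationDB
import HarnessLib

/-!
# The SPECIES-GRADED cumulant expansion: `𝓔ᵀ_C(Σ_s V_s; n)` as the sum over the species-and-degree assignments of the replicas, the
# graded bound of ONE assignment, and the bound of any CLASS of species patterns (determinant-bounded covariances)

Topic `MathematicalPhysics/QuantumLattice`; the multi-species refinement of `GrassmannEffectiveActionLipschitzDB` (two species, flat, the
class «at least one copy of species 1») and of `GrassmannCumulantPolarisedGradedDB` (the one-marked-slot mixed graded sum, inside a telescoping).
For finitely many even interactions `V_s = Σ_{m' ∈ degs} Σ_Y K_s(m',Y) ψ(Y)` (`s ∈ S`) the truncated expectation of the sum is MULTILINEAR in the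
copies (Benfatto–Giuliani–Mastropietro 2006, (2.13)–(2.14), (2.31); `GrassmannCumulantKernelBound.ursellOf_convMoment_eq_sum_piFinset`): every copy
is expanded over the species AND the degrees, `𝓔ᵀ_C(Σ_s V_s; n) = Σ_{η : Fin n → S × degs} collapse 𝓔ᵀ_{C'}(M_{η(0)}, …, M_{η(n−1)})` with `M_{(s,m')}`
the replica of the degree-`2m'` kernel of species `s`; the tree-expansion bound `GrassmannTruncatedBoundDB.sum_norm_kernel_ursellOf_kernelVertex_le_of_gramBounded`
(BGM 2006 (2.77)–(2.80)) bounds ONE assignment by the product of the per-copy weights `g_s(d) = (e²(κ+ρ))^{2d} N_s(d)` on the leg constraint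
`r + 2(n−1) ≤ Σ_a 2δ_a` and by `0` off it; hence the part of `𝓔ᵀ_C(Σ_s V_s; n)` carried by any finite CLASS `𝒞` of species patterns obeys the graded
bound with `Σ_{δ : constraint} Σ_{σ ∈ 𝒞} Π_b g_{σ_b}(δ_b)`:

* **`coe_cumulantOf_sum_vertexOf_eq_sum_piFinset`** — the exact species-and-degree expansion;
* **`sum_filter_norm_kernel_collapse_speciesReplica_le`** — one assignment, on the leg constraint:
  `Σ_{W : W_i = w} ‖kernel_r (collapse 𝓔ᵀ_{C'}(M_η))(W)‖ ≤ n·ρ^{-r}κ^{-2(n−1)}(n−1)!α^{n−1}eⁿ · Π_b g_{η_b}`; `kernel_collapse_speciesReplica_eq_zero_of_lt` — off it;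
* **`sum_norm_kernel_speciesClass_le_graded_of_gramBounded`** — for any finite class `𝒞` of species patterns `σ : Fin n → S`:
  `Σ_{W : W_i = w} ‖Σ_{η : (σ_η) ∈ 𝒞} kernel_r (collapse 𝓔ᵀ_{C'}(M_η))(W)‖ ≤ n!·ρ^{-r}κ^{-2(n−1)}α^{n−1}eⁿ · Σ_{δ ∈ degs^n : r + 2(n−1) ≤ Σ 2δ_a} Σ_{σ ∈ 𝒞} Π_b g_{σ_b}(δ_b)`;
* **`sum_norm_kernel_oneMarked_le_graded_of_gramBounded`** — the class «species `t` at exactly one slot, `s₀` at the others» spelled out: its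
  pattern sum is `Σ_a g_t(δ_a)·Π_{b ≠ a} g_{s₀}(δ_b)` (the mixed graded sum of a Lipschitz / one-source-leg bookkeeping; private `sum_oneMarked_eq`);
  any class «at most `k` marked slots» (`Σ_b w(σ_b) ≤ k` for a weight `w : S → ℕ`) is an instance of the class bound as stated.

This is the replica-level layer of a SOURCE-GRADED single-scale step (kernels with `0, 1, 2` source legs as the species; BGM 2006 §2.9: the step's
output with `≤ 2` source legs is fed exactly by the assignments with `≤ 2` marked slots once source legs are never contracted — that clause is the
consumer's, cell gate-hubbard-kl VL child stmt-…-20440 token #24).  Everything is proved; no definition, no named fact.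

## Sources

G. Benfatto, A. Giuliani, V. Mastropietro, Ann. Henri Poincaré 7 (2006) 809–898, (2.13)–(2.14), (2.31), (2.77)–(2.80), §2.9
[`BenfattoGiulianiMastropietro2006`]; K. Gawȩdzki, A. Kupiainen, Comm. Math. Phys. 102 (1985) 1–30, §3 [`GawedzkiKupiainen1985GrossNeveu`];
D. Ruelle, *Statistical Mechanics: Rigorous Results* (1969), §4.4.2 [`Ruelle1969`].
-/

noncomputable section

namespace Literature.MathematicalPhysics.QuantumLattice

open GrassmannAlgebra Finset Literature.Probability.LatticeModels
open scoped InnerProductSpace Nat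

universe u

variable {𝕜 : Type*} [RCLike 𝕜] {Γ : Type u} [Fintype Γ] [DecidableEq Γ] {n : ℕ} (C : Matrix Γ Γ 𝕜)
variable {S : Type*} [Fintype S] [DecidableEq S]

/-! ### The exact species-and-degree expansion -/

omit [DecidableEq S] in
/-- **The species-and-degree expansion of the truncated expectation** (BGM 2006 (2.13)–(2.14), (2.31): multilinearity in the copies): for
even elements `V_s = Σ_{m' ∈ degs} Σ_Y K_s(m',Y) ψ(Y)`, `s ∈ S`,
`𝓔ᵀ_C(Σ_s V_s; n) = Σ_{η : Fin n → S × degs} collapse 𝓔ᵀ_{C'}(M_{η(0)}, …, M_{η(n−1)})`, `M_{(s,m')}` the replica in its copy of the degree-`2m'` kernel of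
species `s`, `C'` the replica-blind covariance. [cite: BenfattoGiulianiMastropietro2006, (2.13)-(2.14) and (2.31)] -/
theorem coe_cumulantOf_sum_vertexOf_eq_sum_piFinset (degs : Finset ℕ) (Ksp : S → (m' : ℕ) → (Fin (2 * m') → Γ) → 𝕜) (hn : 0 < n) :
    ((cumulantOf (fun k => evenGaussConv 𝕜 C ((∑ s, vertexOf 𝕜 degs (Ksp s)) ^ k)) n : evenPart 𝕜 Γ) : GrassmannAlgebra 𝕜 Γ) =
      ∑ η ∈ Fintype.piFinset (fun _ : Fin n => (univ : Finset S) ×ˢ degs),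
        collapse 𝕜 (Prod.snd : Fin n × Γ → Γ)
          ((ursellOf (convMoment 𝕜 (C.submatrix Prod.snd Prod.snd)
              (kernelVertex 𝕜 (deg := fun b : Fin n => 2 * (η b).2) (fun b => even_two_mul (η b).2)
                fun b => replicaKer 𝕜 (Ksp (η b).1 (η b).2) b)) univ : evenPart 𝕜 (Fin n × Γ)) : GrassmannAlgebra 𝕜 (Fin n × Γ)) := by
  set C' : Matrix (Fin n × Γ) (Fin n × Γ) 𝕜 := C.submatrix Prod.snd Prod.snd with hC'
  have huniv : (univ : Finset (Fin n)).Nonempty := ⟨⟨0, hn⟩, mem_univ _⟩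
  set M' : Fin n → S × ℕ → evenPart 𝕜 (Fin n × Γ) := fun a sm =>
    kernelVertex 𝕜 (deg := fun _ : Fin n => 2 * sm.2) (fun _ => even_two_mul sm.2) (fun b => replicaKer 𝕜 (Ksp sm.1 sm.2) b) a with hM'
  have hM'mem : ∀ a sm, (M' a sm : GrassmannAlgebra 𝕜 (Fin n × Γ)) ∈ fieldSubalgebra 𝕜 ((Prod.fst : Fin n × Γ → Fin n) ⁻¹' {a}) :=
    fun a sm => coe_kernelVertex_replicaKer_mem 𝕜 sm.2 (Ksp sm.1 sm.2) a
  set T : Finset (S × ℕ) := (univ : Finset S) ×ˢ degs with hT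
  have hcollapse : ∀ a, collapseEven 𝕜 (Prod.snd : Fin n × Γ → Γ) (∑ sm ∈ T, M' a sm) = ∑ s, vertexOf 𝕜 degs (Ksp s) := by
    intro a
    rw [hT, sum_product, map_sum]
    exact sum_congr rfl fun s _ => collapseEven_replicaVertex 𝕜 degs (Ksp s) a
  have h1 := collapseEven_ursellOf_convMoment_eq_cumulantOf 𝕜 (Prod.snd : Fin n × Γ → Γ) C (fun a => ∑ sm ∈ T, M' a sm)
    (∑ s, vertexOf 𝕜 degs (Ksp s)) hcollapse huniv
  rw [card_univ, Fintype.card_fin] at h1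
  rw [← h1, coe_collapseEven]
  have h2 : ursellOf (convMoment 𝕜 C' (fun a => ∑ sm ∈ T, M' a sm)) univ =
      ∑ η ∈ Fintype.piFinset (fun _ : Fin n => T), ursellOf (convMoment 𝕜 C'
        (kernelVertex 𝕜 (deg := fun b : Fin n => 2 * (η b).2) (fun b => even_two_mul (η b).2)
          fun b => replicaKer 𝕜 (Ksp (η b).1 (η b).2) b)) univ :=
    ursellOf_convMoment_eq_sum_piFinset 𝕜 C' (Prod.fst : Fin n × Γ → Fin n) (fun _ : Fin n => T) M' hM'mem ⟨0, hn⟩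
  rw [← hC', h2, AddSubmonoidClass.coe_finsetSum, map_sum]

/-! ### One assignment -/

omit [Fintype S] [DecidableEq S] in
/-- **One species-and-degree assignment, on the leg constraint** (BGM 2006 (2.77)–(2.80) for per-copy kernels): with pinned `L¹` norms of
`K_s(m',·)` at most `N_s(m')`, a replica-Gram-bounded covariance (constant `κ`), one-copy row and column sums `≤ α`, an output weight `ρ`: if
`r + 2(n−1) ≤ Σ_a 2δ_a` then for every copy `b` the pinned sum of the `r`-kernels of `𝓔ᵀ_{C'}(M_η)` at a label of copy `b` is at most
`ρ^{-r}κ^{-2(n−1)}(n−1)!α^{n−1}eⁿ · Π_a (e²(κ+ρ))^{2δ_a} N_{η_a}(δ_a)`. [cite: BenfattoGiulianiMastropietro2006, (2.77)-(2.80)] -/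
theorem sum_filter_norm_kernel_speciesReplica_le {κ : ℝ} (hκ : 0 < κ) (hGB : IsGramBoundedR C κ)
    (Ksp : S → (m' : ℕ) → (Fin (2 * m') → Γ) → 𝕜) (Nsp : S → ℕ → ℝ) (hN0 : ∀ s m', 0 ≤ Nsp s m')
    (hN : ∀ s m' (j : Fin (2 * m')) (w : Γ), ∑ Y ∈ univ.filter (fun Y : Fin (2 * m') → Γ => Y j = w), ‖Ksp s m' Y‖ ≤ Nsp s m')
    {α : ℝ} (hα : 0 < α) (hrow : ∀ X, ∑ Y, ‖C X Y‖ ≤ α) (hcol : ∀ Y, ∑ X, ‖C X Y‖ ≤ α) {ρ : ℝ} (hρ : 0 < ρ)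
    (hn : 0 < n) {r : ℕ} (i : Fin r) (w : Γ) (η : Fin n → S × ℕ) (hle : r + 2 * (n - 1) ≤ ∑ a, 2 * (η a).2) (b : Fin n) :
    ∑ W' ∈ univ.filter (fun W' : Fin r → Fin n × Γ => W' i = (b, w)),
        ‖kernel 𝕜 ((ursellOf (convMoment 𝕜 (C.submatrix Prod.snd Prod.snd)
            (kernelVertex 𝕜 (deg := fun b : Fin n => 2 * (η b).2) (fun b => even_two_mul (η b).2)
              fun b => replicaKer 𝕜 (Ksp (η b).1 (η b).2) b)) univ : evenPart 𝕜 (Fin n × Γ)) : GrassmannAlgebra 𝕜 (Fin n × Γ)) r W'‖ ≤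
      (ρ⁻¹ ^ r * κ⁻¹ ^ (2 * (n - 1)) * (((n - 1)! : ℝ) * α ^ (n - 1) * Real.exp n)) *
        ∏ a, (Real.exp 2 * (κ + ρ)) ^ (2 * (η a).2) * Nsp (η a).1 (η a).2 := by
  set C' : Matrix (Fin n × Γ) (Fin n × Γ) 𝕜 := C.submatrix Prod.snd Prod.snd with hC'
  have hGB' : IsGramBounded C' κ := by rw [hC']; exact (hGB.submatrix Prod.snd).isGramBounded
  set δ : Fin n → ℕ := fun a => (η a).2 with hδ
  have hKs : ∀ (v : Fin n) (Yv : Fin (2 * (η v).2) → Fin n × Γ), replicaKer 𝕜 (Ksp (η v).1 (η v).2) v Yv ≠ 0 → ∀ j, (Yv j).1 = v :=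
    fun v Yv h j => replicaKer_support 𝕜 (Ksp (η v).1 (η v).2) v Yv h j
  have hcore := sum_norm_kernel_ursellOf_kernelVertex_le_of_gramBounded C' (Prod.fst : Fin n × Γ → Fin n)
    (fun b => replicaKer 𝕜 (Ksp (η b).1 (η b).2) b) hκ.le hGB'
    (fun b => even_two_mul (η b).2) hKs (fun u => Nsp (η u).1 (η u).2) (fun u => hN0 _ _)
    (fun u j a' => sum_filter_norm_replicaKer_le (Ksp (η u).1 (η u).2) u (hN (η u).1 (η u).2) j a') hα.le
    (fun ℓ X' => sum_norm_typeRestrict_submatrix_le C hα.le hrow ℓ X') (fun ℓ Y' => sum_norm_typeRestrict_submatrix_le' C hα.le hcol ℓ Y')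
    (lam := (α * ((∑ a, (2 * δ a : ℝ)) + n))⁻¹) (by positivity) i (b, w)
  refine hcore.trans ?_
  have hsumδ : (∑ v, 2 * (η v).2) = ∑ a, 2 * δ a := rfl
  have hA := choose_mul_pow_le (N := ∑ a, 2 * δ a) (r := r) (m := 2 * (n - 1)) hle hκ hρ
  have hTr := treeFactor_choice_le hn δ hα
  have hNprod : 0 ≤ ∏ u, Nsp (η u).1 (η u).2 := prod_nonneg fun u _ => hN0 _ _
  have hTnonneg : 0 ≤ ((α * ((∑ a, (2 * δ a : ℝ)) + n))⁻¹)⁻¹ ^ (n - 1) *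
      ∏ ℓ : Sym2 (Fin n), (1 + (α * ((∑ a, (2 * δ a : ℝ)) + n))⁻¹ * (α * (pairDeg (fun a => 2 * δ a) ℓ : ℝ))) := by
    have hs : 0 ≤ ∑ a, (2 * δ a : ℝ) := sum_nonneg fun a _ => by positivity
    exact mul_nonneg (by positivity) (prod_nonneg fun ℓ _ => by positivity)
  have hpd : (pairDeg (fun b : Fin n => 2 * (η b).2)) = pairDeg (fun a => 2 * δ a) := rfl
  rw [hsumδ, hpd]
  calc ((((r.factorial : ℝ))⁻¹ * ((∑ a, 2 * δ a).descFactorial r : ℝ)) * κ ^ ((∑ a, 2 * δ a) - (r + 2 * (n - 1))) *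
          ∏ u, Nsp (η u).1 (η u).2) *
        (((α * ((∑ a, (2 * δ a : ℝ)) + n))⁻¹)⁻¹ ^ (n - 1) *
          ∏ ℓ : Sym2 (Fin n), (1 + (α * ((∑ a, (2 * δ a : ℝ)) + n))⁻¹ * (α * (pairDeg (fun a => 2 * δ a) ℓ : ℝ))))
      ≤ ((ρ⁻¹ ^ r * κ⁻¹ ^ (2 * (n - 1)) * (κ + ρ) ^ (∑ a, 2 * δ a)) * ∏ u, Nsp (η u).1 (η u).2) *
          (((n - 1).factorial : ℝ) * α ^ (n - 1) * Real.exp (2 * (∑ a, (2 * δ a : ℝ)) + n)) :=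
        mul_le_mul (mul_le_mul_of_nonneg_right hA hNprod) hTr hTnonneg (by positivity)
    _ = (ρ⁻¹ ^ r * κ⁻¹ ^ (2 * (n - 1)) * (((n - 1)! : ℝ) * α ^ (n - 1) * Real.exp n)) *
          ∏ a, (Real.exp 2 * (κ + ρ)) ^ (2 * (η a).2) * Nsp (η a).1 (η a).2 := by
        have hexp : Real.exp (2 * (∑ a, (2 * δ a : ℝ)) + n) = Real.exp n * ∏ a, Real.exp 2 ^ (2 * δ a) := by
          rw [Real.exp_add, mul_comm, mul_sum, Real.exp_sum]
          congr 1
          refine prod_congr rfl fun a _ => ?_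
          rw [← Real.exp_nat_mul]
          congr 1
          push_cast
          ring
        rw [hexp, ← prod_pow_eq_pow_sum]
        simp only [hδ, mul_pow, prod_mul_distrib]
        ring

omit [Fintype S] [DecidableEq S] in
/-- **Off the leg constraint every kernel of the assignment's replica cumulant vanishes** (every tree has `n − 1` lines deleting two fields
each; BGM 2006 (2.66)). [cite: BenfattoGiulianiMastropietro2006, (2.66)] -/
theorem kernel_speciesReplica_eq_zero_of_lt {κ : ℝ} (hκ : 0 < κ) (hGB : IsGramBoundedR C κ)
    (Ksp : S → (m' : ℕ) → (Fin (2 * m') → Γ) → 𝕜) (hn : 0 < n) {r : ℕ} (η : Fin n → S × ℕ)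
    (hlt : ¬ r + 2 * (n - 1) ≤ ∑ a, 2 * (η a).2) (W' : Fin r → Fin n × Γ) :
    kernel 𝕜 ((ursellOf (convMoment 𝕜 (C.submatrix Prod.snd Prod.snd)
        (kernelVertex 𝕜 (deg := fun b : Fin n => 2 * (η b).2) (fun b => even_two_mul (η b).2)
          fun b => replicaKer 𝕜 (Ksp (η b).1 (η b).2) b)) univ : evenPart 𝕜 (Fin n × Γ)) : GrassmannAlgebra 𝕜 (Fin n × Γ)) r W' = 0 := by
  have hGB' : IsGramBounded (C.submatrix Prod.snd Prod.snd : Matrix (Fin n × Γ) (Fin n × Γ) 𝕜) κ := (hGB.submatrix Prod.snd).isGramBounded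
  exact kernel_ursellOf_kernelVertex_eq_zero_of_lt_of_gramBounded (C.submatrix Prod.snd Prod.snd) (Prod.fst : Fin n × Γ → Fin n)
    (fun b => replicaKer 𝕜 (Ksp (η b).1 (η b).2) b) hκ.le hGB' (fun b => even_two_mul (η b).2)
    (fun v Yv h j => replicaKer_support 𝕜 (Ksp (η v).1 (η v).2) v Yv h j) ⟨0, hn⟩ (not_le.1 hlt) W'

omit [Fintype S] [DecidableEq S] in
/-- **One assignment, collapsed**: on the leg constraint
`Σ_{W : W_i = w} ‖kernel_r (collapse 𝓔ᵀ_{C'}(M_η))(W)‖ ≤ n·ρ^{-r}κ^{-2(n−1)}(n−1)!α^{n−1}eⁿ · Π_a g_{η_a}`, and `0` off it (`g_s(d) = (e²(κ+ρ))^{2d} N_s(d)`).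
[cite: BenfattoGiulianiMastropietro2006, (2.77)-(2.80)] -/
theorem sum_filter_norm_kernel_collapse_speciesReplica_le {κ : ℝ} (hκ : 0 < κ) (hGB : IsGramBoundedR C κ)
    (Ksp : S → (m' : ℕ) → (Fin (2 * m') → Γ) → 𝕜) (Nsp : S → ℕ → ℝ) (hN0 : ∀ s m', 0 ≤ Nsp s m')
    (hN : ∀ s m' (j : Fin (2 * m')) (w : Γ), ∑ Y ∈ univ.filter (fun Y : Fin (2 * m') → Γ => Y j = w), ‖Ksp s m' Y‖ ≤ Nsp s m')
    {α : ℝ} (hα : 0 < α) (hrow : ∀ X, ∑ Y, ‖C X Y‖ ≤ α) (hcol : ∀ Y, ∑ X, ‖C X Y‖ ≤ α) {ρ : ℝ} (hρ : 0 < ρ)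
    (hn : 0 < n) {r : ℕ} (i : Fin r) (w : Γ) (η : Fin n → S × ℕ) :
    ∑ W ∈ univ.filter (fun W : Fin r → Γ => W i = w),
        ‖kernel 𝕜 (collapse 𝕜 (Prod.snd : Fin n × Γ → Γ)
          ((ursellOf (convMoment 𝕜 (C.submatrix Prod.snd Prod.snd)
              (kernelVertex 𝕜 (deg := fun b : Fin n => 2 * (η b).2) (fun b => even_two_mul (η b).2)
                fun b => replicaKer 𝕜 (Ksp (η b).1 (η b).2) b)) univ : evenPart 𝕜 (Fin n × Γ)) : GrassmannAlgebra 𝕜 (Fin n × Γ))) r W‖ ≤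
      if r + 2 * (n - 1) ≤ ∑ a, 2 * (η a).2 then
        (n : ℝ) * ((ρ⁻¹ ^ r * κ⁻¹ ^ (2 * (n - 1)) * (((n - 1)! : ℝ) * α ^ (n - 1) * Real.exp n)) *
          ∏ a, (Real.exp 2 * (κ + ρ)) ^ (2 * (η a).2) * Nsp (η a).1 (η a).2)
      else 0 := by
  split_ifs with hle
  · calc _ ≤ ∑ b : Fin n, ∑ W' ∈ univ.filter (fun W' : Fin r → Fin n × Γ => W' i = (b, w)),
          ‖kernel 𝕜 ((ursellOf (convMoment 𝕜 (C.submatrix Prod.snd Prod.snd)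
              (kernelVertex 𝕜 (deg := fun b : Fin n => 2 * (η b).2) (fun b => even_two_mul (η b).2)
                fun b => replicaKer 𝕜 (Ksp (η b).1 (η b).2) b)) univ : evenPart 𝕜 (Fin n × Γ)) : GrassmannAlgebra 𝕜 (Fin n × Γ)) r W'‖ :=
          sum_filter_norm_kernel_collapse_le _ i w
      _ ≤ ∑ _b : Fin n, (ρ⁻¹ ^ r * κ⁻¹ ^ (2 * (n - 1)) * (((n - 1)! : ℝ) * α ^ (n - 1) * Real.exp n)) *
          ∏ a, (Real.exp 2 * (κ + ρ)) ^ (2 * (η a).2) * Nsp (η a).1 (η a).2 :=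
          sum_le_sum fun b _ => sum_filter_norm_kernel_speciesReplica_le C hκ hGB Ksp Nsp hN0 hN hα hrow hcol hρ hn i w η hle b
      _ = _ := by rw [sum_const, card_univ, Fintype.card_fin, nsmul_eq_mul]
  · refine le_of_eq (sum_eq_zero fun W _ => ?_)
    rw [kernel_collapse, sum_eq_zero fun W' _ => kernel_speciesReplica_eq_zero_of_lt C hκ hGB Ksp hn η hle W', norm_zero]

/-! ### A class of species patterns -/

/-- **The part of `𝓔ᵀ_C(Σ_s V_s; n)` carried by a CLASS of species patterns obeys the graded bound** (BGM 2006 (2.13)–(2.14) with (2.77)–(2.80),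
the leg constraint KEPT): for any finite set `𝒞` of patterns `σ : Fin n → S`, one output label pinned and the others summed,
`Σ_{W : W_i = w} ‖Σ_{η : Fin n → S × degs, (σ_η) ∈ 𝒞} kernel_r (collapse 𝓔ᵀ_{C'}(M_η))(W)‖ ≤
   n!·ρ^{-r}κ^{-2(n−1)}α^{n−1}eⁿ · Σ_{δ ∈ degs^n : r + 2(n−1) ≤ Σ 2δ_a} Σ_{σ ∈ 𝒞} Π_b (e²(κ+ρ))^{2δ_b} N_{σ_b}(δ_b)`.
With `𝒞 = {all patterns}` and one species this is `GrassmannEffectiveActionGradedTruncationDB.sum_norm_kernel_cumulantOf_le_graded_of_gramBounded`; with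
`𝒞 = ` «at most `k` marked slots» it is the replica layer of a source-graded step. [cite: BenfattoGiulianiMastropietro2006, (2.13)-(2.14) and (2.77)-(2.80)] -/
theorem sum_norm_kernel_speciesClass_le_graded_of_gramBounded {κ : ℝ} (hκ : 0 < κ) (hGB : IsGramBoundedR C κ)
    (degs : Finset ℕ) (Ksp : S → (m' : ℕ) → (Fin (2 * m') → Γ) → 𝕜) (Nsp : S → ℕ → ℝ) (hN0 : ∀ s m', 0 ≤ Nsp s m')
    (hN : ∀ s m' (j : Fin (2 * m')) (w : Γ), ∑ Y ∈ univ.filter (fun Y : Fin (2 * m') → Γ => Y j = w), ‖Ksp s m' Y‖ ≤ Nsp s m')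
    {α : ℝ} (hα : 0 < α) (hrow : ∀ X, ∑ Y, ‖C X Y‖ ≤ α) (hcol : ∀ Y, ∑ X, ‖C X Y‖ ≤ α) {ρ : ℝ} (hρ : 0 < ρ)
    (hn : 0 < n) (𝒞 : Finset (Fin n → S)) {r : ℕ} (i : Fin r) (w : Γ) :
    ∑ W ∈ univ.filter (fun W : Fin r → Γ => W i = w),
        ‖∑ η ∈ (Fintype.piFinset (fun _ : Fin n => (univ : Finset S) ×ˢ degs)).filter (fun η => (fun b => (η b).1) ∈ 𝒞),
          kernel 𝕜 (collapse 𝕜 (Prod.snd : Fin n × Γ → Γ)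
            ((ursellOf (convMoment 𝕜 (C.submatrix Prod.snd Prod.snd)
                (kernelVertex 𝕜 (deg := fun b : Fin n => 2 * (η b).2) (fun b => even_two_mul (η b).2)
                  fun b => replicaKer 𝕜 (Ksp (η b).1 (η b).2) b)) univ : evenPart 𝕜 (Fin n × Γ)) : GrassmannAlgebra 𝕜 (Fin n × Γ))) r W‖ ≤
      (n ! : ℝ) * (ρ⁻¹ ^ r * κ⁻¹ ^ (2 * (n - 1)) * (α ^ (n - 1) * Real.exp n)) *
        ∑ δ ∈ (Fintype.piFinset fun _ : Fin n => degs) with r + 2 * (n - 1) ≤ ∑ a, 2 * δ a,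
          ∑ σ ∈ 𝒞, ∏ b, (Real.exp 2 * (κ + ρ)) ^ (2 * δ b) * Nsp (σ b) (δ b) := by
  -- abbreviations
  set T : Finset (S × ℕ) := (univ : Finset S) ×ˢ degs with hT
  set Δ : Finset (Fin n → ℕ) := Fintype.piFinset (fun _ : Fin n => degs) with hΔ
  set c : ℝ := ρ⁻¹ ^ r * κ⁻¹ ^ (2 * (n - 1)) * (((n - 1)! : ℝ) * α ^ (n - 1) * Real.exp n) with hc
  set g : S × ℕ → ℝ := fun sm => (Real.exp 2 * (κ + ρ)) ^ (2 * sm.2) * Nsp sm.1 sm.2 with hg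
  set U : (Fin n → S × ℕ) → GrassmannAlgebra 𝕜 (Fin n × Γ) := fun η =>
    ((ursellOf (convMoment 𝕜 (C.submatrix Prod.snd Prod.snd)
      (kernelVertex 𝕜 (deg := fun b : Fin n => 2 * (η b).2) (fun b => even_two_mul (η b).2)
        fun b => replicaKer 𝕜 (Ksp (η b).1 (η b).2) b)) univ : evenPart 𝕜 (Fin n × Γ)) : GrassmannAlgebra 𝕜 (Fin n × Γ)) with hU
  set F : Finset (Fin n → S × ℕ) := (Fintype.piFinset (fun _ : Fin n => T)).filter (fun η => (fun b => (η b).1) ∈ 𝒞) with hF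
  -- the bound of one assignment, as an `if`
  set B : (Fin n → S × ℕ) → ℝ := fun η => if r + 2 * (n - 1) ≤ ∑ a, 2 * (η a).2 then (n : ℝ) * (c * ∏ a, g (η a)) else 0 with hB
  have hBη : ∀ η, ∑ W ∈ univ.filter (fun W : Fin r → Γ => W i = w), ‖kernel 𝕜 (collapse 𝕜 (Prod.snd : Fin n × Γ → Γ) (U η)) r W‖ ≤ B η :=
    fun η => sum_filter_norm_kernel_collapse_speciesReplica_le C hκ hGB Ksp Nsp hN0 hN hα hrow hcol hρ hn i w η
  -- split an assignment into its species pattern and its degrees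
  set e : (Fin n → S × ℕ) ≃ (Fin n → S) × (Fin n → ℕ) := Equiv.arrowProdEquivProdArrow (Fin n) (fun _ => S) (fun _ => ℕ) with he
  have hsplit : ∑ η ∈ F, B η = ∑ p ∈ 𝒞 ×ˢ Δ, (if r + 2 * (n - 1) ≤ ∑ a, 2 * p.2 a then (n : ℝ) * (c * ∏ a, g (p.1 a, p.2 a)) else 0) := by
    refine sum_equiv e (fun η => ?_) (fun η _ => ?_)
    · rw [hF, mem_filter, Fintype.mem_piFinset, mem_product, hΔ, Fintype.mem_piFinset, he]
      simp only [Equiv.arrowProdEquivProdArrow_apply, hT, mem_product, mem_univ, true_and]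
      tauto
    · rw [hB, he]
      simp only [Equiv.arrowProdEquivProdArrow_apply, Prod.mk.eta]
  -- assemble
  calc ∑ W ∈ univ.filter (fun W : Fin r → Γ => W i = w), ‖∑ η ∈ F, kernel 𝕜 (collapse 𝕜 (Prod.snd : Fin n × Γ → Γ) (U η)) r W‖
      ≤ ∑ W ∈ univ.filter (fun W : Fin r → Γ => W i = w), ∑ η ∈ F, ‖kernel 𝕜 (collapse 𝕜 (Prod.snd : Fin n × Γ → Γ) (U η)) r W‖ :=
        sum_le_sum fun W _ => norm_sum_le _ _
    _ = ∑ η ∈ F, ∑ W ∈ univ.filter (fun W : Fin r → Γ => W i = w), ‖kernel 𝕜 (collapse 𝕜 (Prod.snd : Fin n × Γ → Γ) (U η)) r W‖ :=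
        sum_comm
    _ ≤ ∑ η ∈ F, B η := sum_le_sum fun η _ => hBη η
    _ = ∑ p ∈ 𝒞 ×ˢ Δ, (if r + 2 * (n - 1) ≤ ∑ a, 2 * p.2 a then (n : ℝ) * (c * ∏ a, g (p.1 a, p.2 a)) else 0) := hsplit
    _ = ∑ σ ∈ 𝒞, ∑ δ ∈ Δ with r + 2 * (n - 1) ≤ ∑ a, 2 * δ a, (n : ℝ) * (c * ∏ a, g (σ a, δ a)) := by
        rw [sum_product]
        exact sum_congr rfl fun σ _ => (sum_filter _ _).symm
    _ = (n : ℝ) * c * ∑ δ ∈ Δ with r + 2 * (n - 1) ≤ ∑ a, 2 * δ a, ∑ σ ∈ 𝒞, ∏ b, g (σ b, δ b) := by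
        rw [sum_comm, mul_sum]
        refine sum_congr rfl fun δ _ => ?_
        rw [mul_sum]
        exact sum_congr rfl fun σ _ => by ring
    _ = _ := by
        rw [hc, ← Nat.mul_factorial_pred (Nat.pos_iff_ne_zero.1 hn), Nat.cast_mul]
        ring

/-! ### The one-marked-slot class spelled out -/

omit [Fintype S] [DecidableEq S] in
/-- The patterns «species `t` at exactly the slot `a`, species `s₀` elsewhere» are distinct for distinct `a` (`t ≠ s₀`). [folklore] -/
private theorem update_const_injective {s₀ t : S} (hts : t ≠ s₀) :
    Function.Injective (fun a : Fin n => Function.update (fun _ : Fin n => s₀) a t) := by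
  intro a a' h
  by_contra hne
  have h1 : Function.update (fun _ : Fin n => s₀) a t a = Function.update (fun _ : Fin n => s₀) a' t a := congrFun h a
  rw [Function.update_self, Function.update_of_ne hne] at h1
  exact hts h1

omit [Fintype S] in
/-- The one-marked-slot class spelled out: over the patterns `σ_a = (s₀,…,s₀, t at slot a, s₀,…,s₀)`, `a ∈ Fin n` (`t ≠ s₀`), a pattern sum of
products is the mixed term `Σ_a G_t(δ_a) · Π_{b ≠ a} G_{s₀}(δ_b)`. [folklore] -/
private theorem sum_oneMarked_eq {s₀ t : S} (hts : t ≠ s₀) (G : S → ℕ → ℝ) (δ : Fin n → ℕ) :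
    ∑ σ ∈ (univ : Finset (Fin n)).image (fun a => Function.update (fun _ : Fin n => s₀) a t), ∏ b, G (σ b) (δ b) =
      ∑ a, G t (δ a) * ∏ b ∈ univ.erase a, G s₀ (δ b) := by
  rw [sum_image fun a _ a' _ h => update_const_injective hts h]
  refine sum_congr rfl fun a _ => ?_
  rw [← mul_prod_erase univ (fun b => G (Function.update (fun _ : Fin n => s₀) a t b) (δ b)) (mem_univ a), Function.update_self]
  congr 1
  exact prod_congr rfl fun b hb => by rw [Function.update_of_ne (ne_of_mem_erase hb)]

/-- **The ONE-MARKED-SLOT class of the species-graded cumulant bound, spelled out** (BGM 2006 (2.13)–(2.14) with (2.77)–(2.80); §2.9: one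
source-sector vertex among in-band ones, or the one-slot telescoping of a Lipschitz comparison): for two species `s₀ ≠ t`, the part of
`𝓔ᵀ_C(Σ_s V_s; n)` carried by the patterns «species `t` at exactly one slot, species `s₀` at all others» obeys, one output label pinned,
`Σ_{W : W_i = w} ‖Σ_{η : (σ_η) one-marked} kernel_r (collapse 𝓔ᵀ_{C'}(M_η))(W)‖ ≤
   n!·ρ^{-r}κ^{-2(n−1)}α^{n−1}eⁿ · Σ_{δ ∈ degs^n : r + 2(n−1) ≤ Σ 2δ_a} Σ_a g_t(δ_a)·Π_{b ≠ a} g_{s₀}(δ_b)`, `g_s(d) = (e²(κ+ρ))^{2d} N_s(d)`.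
[cite: BenfattoGiulianiMastropietro2006, (2.13)-(2.14) and (2.77)-(2.80)] -/
theorem sum_norm_kernel_oneMarked_le_graded_of_gramBounded {κ : ℝ} (hκ : 0 < κ) (hGB : IsGramBoundedR C κ)
    (degs : Finset ℕ) (Ksp : S → (m' : ℕ) → (Fin (2 * m') → Γ) → 𝕜) (Nsp : S → ℕ → ℝ) (hN0 : ∀ s m', 0 ≤ Nsp s m')
    (hN : ∀ s m' (j : Fin (2 * m')) (w : Γ), ∑ Y ∈ univ.filter (fun Y : Fin (2 * m') → Γ => Y j = w), ‖Ksp s m' Y‖ ≤ Nsp s m')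
    {α : ℝ} (hα : 0 < α) (hrow : ∀ X, ∑ Y, ‖C X Y‖ ≤ α) (hcol : ∀ Y, ∑ X, ‖C X Y‖ ≤ α) {ρ : ℝ} (hρ : 0 < ρ)
    (hn : 0 < n) {s₀ t : S} (hts : t ≠ s₀) {r : ℕ} (i : Fin r) (w : Γ) :
    ∑ W ∈ univ.filter (fun W : Fin r → Γ => W i = w),
        ‖∑ η ∈ (Fintype.piFinset (fun _ : Fin n => (univ : Finset S) ×ˢ degs)).filter
            (fun η => (fun b => (η b).1) ∈ (univ : Finset (Fin n)).image (fun a => Function.update (fun _ : Fin n => s₀) a t)),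
          kernel 𝕜 (collapse 𝕜 (Prod.snd : Fin n × Γ → Γ)
            ((ursellOf (convMoment 𝕜 (C.submatrix Prod.snd Prod.snd)
                (kernelVertex 𝕜 (deg := fun b : Fin n => 2 * (η b).2) (fun b => even_two_mul (η b).2)
                  fun b => replicaKer 𝕜 (Ksp (η b).1 (η b).2) b)) univ : evenPart 𝕜 (Fin n × Γ)) : GrassmannAlgebra 𝕜 (Fin n × Γ))) r W‖ ≤
      (n ! : ℝ) * (ρ⁻¹ ^ r * κ⁻¹ ^ (2 * (n - 1)) * (α ^ (n - 1) * Real.exp n)) *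
        ∑ δ ∈ (Fintype.piFinset fun _ : Fin n => degs) with r + 2 * (n - 1) ≤ ∑ a, 2 * δ a,
          ∑ a, (Real.exp 2 * (κ + ρ)) ^ (2 * δ a) * Nsp t (δ a) * ∏ b ∈ univ.erase a, (Real.exp 2 * (κ + ρ)) ^ (2 * δ b) * Nsp s₀ (δ b) := by
  have h := sum_norm_kernel_speciesClass_le_graded_of_gramBounded C hκ hGB degs Ksp Nsp hN0 hN hα hrow hcol hρ hn
    ((univ : Finset (Fin n)).image (fun a => Function.update (fun _ : Fin n => s₀) a t)) i w
  refine h.trans (le_of_eq ?_)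
  congr 1
  refine sum_congr rfl fun δ _ => ?_
  exact sum_oneMarked_eq hts (fun s d => (Real.exp 2 * (κ + ρ)) ^ (2 * d) * Nsp s d) δ

end Literature.MathematicalPhysics.QuantumLattice

end
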